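import Mathlib
import Literature.NumberTheory.LFunctions.Zhang2022.Section15BEq1517Reindex
import Literature.NumberTheory.LFunctions.Zhang2022.Section15BEq1517WeightSumCube
import Literature.NumberTheory.LFunctions.Zhang2022.Section15BCalR1starBound
import Literature.NumberTheory.LFunctions.Zhang2022.Section15ThinRange1517
import Literature.NumberTheory.LFunctions.Zhang2022.Section15Bcoef
import Literature.NumberTheory.LFunctions.Zhang2022.Section15Eq1523Edge
import Literature.NumberTheory.LFunctions.Zhang2022.SkeletonWindowPowers
import HarnessLib

/-!
# Zhang (2022), §15 (15.17): the assembly edge `eq15_17_chi_of` — (15.17) at `χ·b` from (15.11),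
# the ranged+weighted (15.15), and the sizes of `ℛ₁*`, `b`, `φ(D)` (the `o(p)` bookkeeping)

Topic `Literature/NumberTheory/LFunctions/Zhang2022` (Landau–Siegel audit tree; verdict-neutral).
Y. Zhang, *Discrete mean estimates and the Landau–Siegel zero*, arXiv:2211.02515v1 (2022)
[Zhang2022LandauSiegel] — **an unrefereed manuscript under adjudication; nothing here asserts or denies
its Theorems 1–2.** §15 p. 85, tex L4226–4230: "Inserting this [(15.15)] into (15.11) and substituting
`n = dl` we obtain (15.17) `Φ₁(p) = ℛ₁*Dpφ(D)⁻¹Σ_{j≤3}ℛ_{1j}𝒮_{1j} + o(p)`." This file PROVES the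
deduction for the χ-absorbed coefficients of record (`Typed.Section15A.bChi`, leaf `Eq15_17 c′ bChi` of
`Skeleton.theorem1_of_leaves_v2x`) from

* (15.11) at `bChi` — `Typed.Section15A.Eq15_11 c′ bChi` (hypothesis `h11`), and
* the RANGED + WEIGHTED (15.15) (hypothesis `h15W`, the lane's theorem `eq15_15_ranged` of seat zl-w15-p1,
  here GENERIC in its termwise error `E(D)·∏_{q∣dl}(1 + c₀q^{−9/10})` — only `E(D)·𝓛⁶⁰ → 0` is used, which
  both the printed `O(ε₁) = O(e^{−c𝓛^{1/10}})` and the derivable `O(e^{−c𝓛^{1/10}} + 𝓛^{−1995})` (the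
  residue at `ρ̃ − 1`) satisfy; the range `dl < P·t₀/T³` and the coprimality `(dl,D) = 1` of its
  hypotheses are exactly where `(χ·b)(dl) ≠ 0` can happen, by the support of `b`
  (`Skeleton.bcoef_eq_zero_of_P4_div_bigT_le`) and `χ(dl) ≠ 0`),

with the tree's sizes: `|ℛ₁*| ≪ 𝓛²` (`Typed.Section15A.norm_calR1star_le`), `|b(n)| ≪ τ₂(n)` ((15.2),
`Skeleton.norm_bcoef_le`), `D/φ(D) ≤ 2 log 𝓛` (`Ded1524.self_div_totient_le_two_mul_loglog`), the
substitution `n = dl` (`sum_box_main_eq_sum_calR1_mul_calS1`), the divisor-weight average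
`Σ_{d,l≤P} τ₂(dl)W(dl)/(dl) ≪ 𝓛⁵⁴` (`sum_box_tau_two_mul_weight_div_le_six`), and `p > P` on the prime
window (`Skeleton.bigP_lt_of_mem_primeWindow`):

* **`eq15_17_chi_of : Eq15_11 c′ bChi → (15.15)W[generic error] → Eq15_17 c′ bChi`.**

Theorems only; no definitions, no facts; nothing about Landau–Siegel zeros.

## References

* Y. Zhang, arXiv:2211.02515v1 (2022), §15 (15.11) p. 83, (15.15)–(15.17) p. 85 (tex L4226–4230).
  [cite: Zhang2022LandauSiegel, §15 (15.17) p.85]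
-/

noncomputable section

open Complex Real Finset

namespace Literature.NumberTheory.LFunctions.Zhang2022.Typed.Section15B

open Literature.NumberTheory.LFunctions.Zhang2022
open Literature.NumberTheory.LFunctions.Zhang2022.Skeleton
open Literature.NumberTheory.LFunctions.Zhang2022.Typed.Section15A
open Literature.NumberTheory.LFunctions.Zhang2022.MeanSquareMajorant (tau tau_nonneg)

/-! ## Small inputs -/

/-- For every `L₀` there is `D₀` with `𝓛 = log D ≥ L₀` for `D ≥ D₀`. [folklore] -/
private theorem exists_nat_ell_ge (L₀ : ℝ) :
    ∃ D₀ : ℕ, ∀ D : ℕ, D₀ ≤ D → L₀ ≤ ell D := by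
  refine ⟨⌈Real.exp L₀⌉₊ + 1, fun D hD => ?_⟩
  have h1 : Real.exp L₀ ≤ D := by
    have : (⌈Real.exp L₀⌉₊ : ℝ) + 1 ≤ D := by exact_mod_cast hD
    linarith [Nat.le_ceil (Real.exp L₀)]
  have hD0 : (0 : ℝ) < D := lt_of_lt_of_le (Real.exp_pos L₀) h1
  unfold ell
  rw [Real.le_log_iff_exp_le hD0]
  exact h1

/-- `(χ·b)(n) ≠ 0` forces `(n, D) = 1` (`χ` vanishes on non-units). [cite: Zhang2022LandauSiegel, §15 (15.1)] -/
private theorem coprime_of_bChi_ne_zero {D : ℕ} (χ : DirichletCharacter ℂ D) {n : ℕ}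
    (h : bChi D χ n ≠ 0) : Nat.Coprime n D := by
  have hχ : χ (n : ZMod D) ≠ 0 := by
    intro h0; apply h; simp [bChi, bchi, h0]
  by_contra hnc
  exact hχ (χ.map_nonunit (mt (ZMod.isUnit_iff_coprime n D).mp hnc))

/-- `(χ·b)(n) ≠ 0` forces `b(n) ≠ 0`, hence `n < P₄/T = P·t₀/T³` (support of `b`, (15.2)).
[cite: Zhang2022LandauSiegel, §15 (15.2)] -/
private theorem lt_of_bChi_ne_zero {D : ℕ} (χ : DirichletCharacter ℂ D) (hD : 3 ≤ ell D) {n : ℕ}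
    (h : bChi D χ n ≠ 0) : (n : ℝ) < bigP D * t0 D / bigT D ^ 3 := by
  have hb : bcoef D n ≠ 0 := by
    intro h0; apply h; simp [bChi, bchi, h0]
  rw [← P4_div_bigT_eq]
  by_contra hle
  push Not at hle
  exact hb (bcoef_eq_zero_of_P4_div_bigT_le hD hle)

/-- `‖(χ·b)(n)‖ ≤ C_b τ₂(n)`, `C_b = (1+|ι₂|)(|ι₃|+|ι₄|)` ((15.2), `Skeleton.norm_bcoef_le`; `|χ| ≤ 1`).
[cite: Zhang2022LandauSiegel, §15 (15.2)] -/
private theorem norm_bChi_le {D : ℕ} (χ : DirichletCharacter ℂ D) (hD : 2 ≤ Real.log D) (n : ℕ) :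
    ‖bChi D χ n‖ ≤ (1 + ‖iota2‖) * (‖iota3‖ + ‖iota4‖) * tau 2 n := by
  have h := norm_bcoef_le (D := D) hD n
  have e : bChi D χ n = χ (n : ZMod D) * bcoef D n := rfl
  rw [e, norm_mul]
  calc ‖χ (n : ZMod D)‖ * ‖bcoef D n‖ ≤ 1 * ‖bcoef D n‖ :=
        mul_le_mul_of_nonneg_right (χ.norm_le_one _) (norm_nonneg _)
    _ ≤ _ := by rw [one_mul]; exact h

/-- The weight at `c₀` is dominated by the weight at `|c₀|`: `|∏(1 + c₀x_q)| ≤ ∏(1 + |c₀|x_q)` (`x_q ≥ 0`).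
[folklore] -/
private theorem weight_le_weight_abs (c₀ : ℝ) (n : ℕ) :
    ∏ q ∈ n.primeFactors, (1 + c₀ * (q : ℝ) ^ (-(9 / 10 : ℝ))) ≤
      ∏ q ∈ n.primeFactors, (1 + |c₀| * (q : ℝ) ^ (-(9 / 10 : ℝ))) := by
  refine (le_abs_self _).trans ?_
  rw [Finset.abs_prod]
  refine Finset.prod_le_prod (fun _ _ => abs_nonneg _) fun q _ => ?_
  have hq0 : 0 ≤ (q : ℝ) ^ (-(9 / 10 : ℝ)) := Real.rpow_nonneg (Nat.cast_nonneg q) _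
  calc |1 + c₀ * (q : ℝ) ^ (-(9 / 10 : ℝ))| ≤ |(1 : ℝ)| + |c₀ * (q : ℝ) ^ (-(9 / 10 : ℝ))| := abs_add_le _ _
    _ = 1 + |c₀| * (q : ℝ) ^ (-(9 / 10 : ℝ)) := by rw [abs_one, abs_mul, abs_of_nonneg hq0]

/-! ## The assembly -/

set_option maxHeartbeats 1600000 in -- one long `o(p)` bookkeeping (box sums × four size inputs)
/-- **(15.17) at `χ·b` from (15.11) and the ranged+weighted (15.15)** (§15 p. 85: "Inserting this
into (15.11) and substituting `n = dl` we obtain (15.17)"). Hypotheses: `h11` = `Eq15_11 c′ bChi`;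
`h15W` = the ranged+weighted (15.15) with a termwise error `E(D)·∏_{q∣dl}(1 + c₀q^{−9/10})` on
`dl < P·t₀/T³`, `(dl,D) = 1`, where `E(D)·𝓛⁶⁰ → 0`. Proof: on the support of `χ·b` both side
conditions of `h15W` hold; the main terms recombine into `Σⱼℛ₁ⱼ𝒮₁ⱼ` (`sum_box_main_eq_sum_calR1_mul_calS1`);
the error is `≤ |ℛ₁*|·Dp/φ(D)·C_b·E(D)·Σ_{d,l≤P}τ₂(dl)W(dl)/(dl) ≤ p·E(D)·O(𝓛²·log 𝓛·𝓛⁵⁴) = o(p)`;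
(15.11)'s `ε·P ≤ ε·p` on the window. [cite: Zhang2022LandauSiegel, §15 (15.17) p.85] -/
theorem eq15_17_chi_of (c' : ℝ) (h11 : Eq15_11 c' bChi)
    (h15W : ∃ c₀ : ℝ, ∃ E : ℕ → ℝ,
      (∀ δ : ℝ, 0 < δ → ForAllLarge fun D _ _ => 0 ≤ E D ∧ E D * ell D ^ 60 ≤ δ) ∧
      ForAllLarge fun D _ χ => AssumptionA D χ → ∀ d l : ℕ, 1 ≤ d → 1 ≤ l →
        ((d * l : ℕ) : ℝ) < bigP D * t0 D / bigT D ^ 3 → Nat.Coprime (d * l) D →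
          ‖calD1 c' χ d l -
              lam1 c' χ d 1 * ∑ j ∈ ({1, 2, 3} : Finset ℕ),
                calR1 c' χ j * (d : ℂ) ^ betaJ c' D j * calM1 c' χ d l (1 - betaJ c' D j)‖ ≤
            E D * ∏ q ∈ (d * l).primeFactors, (1 + c₀ * (q : ℝ) ^ (-(9 / 10 : ℝ)))) :
    Eq15_17 c' bChi := by
  intro ε hε
  obtain ⟨c₀, E, hEdec, h15⟩ := h15W
  obtain ⟨CR, hCR0, hR⟩ := norm_calR1star_le c'
  obtain ⟨Cw, hCw0, hw⟩ := sum_box_tau_two_mul_weight_div_le_six (abs_nonneg c₀)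
  obtain ⟨D₁, hφ⟩ := Ded1524.self_div_totient_le_two_mul_loglog
  obtain ⟨D₂, hD₂⟩ := exists_nat_ell_ge 3
  set Cb : ℝ := (1 + ‖iota2‖) * (‖iota3‖ + ‖iota4‖) with hCb
  have hCb0 : 0 ≤ Cb := by rw [hCb]; positivity
  -- the absolute constant in front of `E(D)·𝓛⁵⁷·p`
  set K : ℝ := CR * 2 * Cb * Cw * 2 ^ 6 with hK
  have hK0 : 0 ≤ K := by rw [hK]; positivity
  set δ : ℝ := ε / (2 * (K + 1)) with hδ
  have hδ0 : 0 < δ := by rw [hδ]; positivity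
  have hLarge : ForAllLarge fun D _ _ => D₁ ≤ D ∧ D₂ ≤ D :=
    ForAllLarge.of_le (max D₁ D₂) fun D _ _ hD _ _ =>
      ⟨(le_max_left _ _).trans hD, (le_max_right _ _).trans hD⟩
  refine (((((h11 (ε / 2) (by positivity)).and h15).and hR).and bChi_eq_zero_of_bigP_le).and
    ((hEdec δ hδ0).and hLarge)).mono ?_
  intro D _ χ _ _ ⟨⟨⟨⟨e11, e15⟩, eR⟩, esupp⟩, ⟨hE0, hEδ⟩, hD₁', hD₂'⟩ hA p hp
  -- parameters
  set ℓ : ℝ := ell D with hℓdef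
  have hℓ3 : 3 ≤ ℓ := hD₂ D hD₂'
  have hℓ1 : 1 ≤ ℓ := by linarith
  have hℓ0 : 0 < ℓ := by linarith
  have hlog2 : 2 ≤ Real.log D := by show 2 ≤ ell D; linarith
  set P : ℝ := bigP D with hPdef
  have hP1 : 1 ≤ P := by rw [hPdef, bigP]; exact Real.one_le_exp (by positivity)
  have hPp : P < p := bigP_lt_of_mem_primeWindow hp
  have hp0 : (0 : ℝ) < p := by linarith
  set N : ℕ := ⌊P⌋₊ with hNdef
  have hN2 : 2 ≤ N := by
    rw [hNdef]
    have h27 : (3 : ℝ) ≤ P := by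
      rw [hPdef, bigP]
      have h1 : (3 : ℝ) ≤ ell D ^ 9 := hℓ3.trans (le_self_pow₀ hℓ1 (by norm_num))
      have := Real.add_one_le_exp (ell D ^ 9)
      linarith
    exact Nat.le_floor (by norm_num; linarith)
  have hlogN : Real.log ((N : ℝ) + 1) ≤ 2 * ℓ ^ 9 := by
    have hN1 : (N : ℝ) + 1 ≤ 2 * P := by
      have := Nat.floor_le (show 0 ≤ P by linarith); rw [← hNdef] at this; linarith
    have h0 : (0 : ℝ) < (N : ℝ) + 1 := by positivity
    calc Real.log ((N : ℝ) + 1) ≤ Real.log (2 * P) := Real.log_le_log h0 hN1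
      _ = Real.log 2 + ℓ ^ 9 := by
          rw [Real.log_mul (by norm_num) (by linarith), hPdef, bigP, Real.log_exp]
      _ ≤ 2 * ℓ ^ 9 := by
          have : (1 : ℝ) ≤ ℓ ^ 9 := one_le_pow₀ hℓ1
          linarith [Real.log_two_lt_d9]
  -- the sizes
  have hRs : ‖calR1star c' χ‖ ≤ CR * ℓ ^ 2 := eR hA
  have hDφ : (D : ℝ) / Nat.totient D ≤ 2 * Real.log ℓ := hφ D hD₁'
  have hlogℓ : Real.log ℓ ≤ ℓ := (Real.log_le_sub_one_of_pos hℓ0).trans (by linarith)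
  have hD0 : (0 : ℝ) < D := by exact_mod_cast Nat.pos_of_ne_zero (NeZero.ne D)
  have hφ0 : (0 : ℝ) < Nat.totient D := by
    exact_mod_cast Nat.totient_pos.mpr (by exact_mod_cast hD0)
  -- notation for the sums
  set b : ℕ → ℂ := bChi D χ with hbdef
  have hb0 : ∀ n : ℕ, bigP D ≤ n → b n = 0 := fun n hn => esupp n hn
  set mainDL : ℕ → ℕ → ℂ := fun d l => lam1 c' χ d 1 * ∑ j ∈ ({1, 2, 3} : Finset ℕ),
    calR1 c' χ j * (d : ℂ) ^ betaJ c' D j * calM1 c' χ d l (1 - betaJ c' D j) with hmainDL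
  set W : ℕ → ℝ := fun n => ∏ q ∈ n.primeFactors, (1 + |c₀| * (q : ℝ) ^ (-(9 / 10 : ℝ))) with hWdef
  set Rpre : ℂ := calR1star c' χ * (D : ℂ) * (p : ℂ) / (Nat.totient D : ℂ) with hRpre
  set S1 : ℂ := ∑ d ∈ Icc 1 N, ∑ l ∈ Icc 1 N, b (d * l) * χ (l : ZMod D) / ((d : ℂ) * l) *
    calD1 c' χ d l with hS1
  set S2 : ℂ := ∑ d ∈ Icc 1 N, ∑ l ∈ Icc 1 N, b (d * l) * χ (l : ZMod D) / ((d : ℂ) * l) *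
    mainDL d l with hS2
  -- (15.11) at ε/2
  have h1 : ‖Phi1pOf c' χ b p - Rpre * S1‖ ≤ ε / 2 * P := by
    have := e11 hA p hp
    simpa only [hbdef, hRpre, hS1, hNdef, hPdef] using this
  -- the main terms: `S2 = Σⱼ ℛ₁ⱼ·𝒮₁ⱼ`
  have h2 : S2 = ∑ j ∈ ({1, 2, 3} : Finset ℕ), calR1 c' χ j * calS1 c' χ b j := by
    have := sum_box_main_eq_sum_calR1_mul_calS1 c' χ b hb0
    simpa only [hS2, hmainDL, hNdef, hPdef] using this
  -- termwise error bound on the box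
  have hterm : ∀ d ∈ Icc 1 N, ∀ l ∈ Icc 1 N,
      ‖b (d * l) * χ (l : ZMod D) / ((d : ℂ) * l) * (calD1 c' χ d l - mainDL d l)‖ ≤
        Cb * E D * (tau 2 (d * l) * W (d * l) / ((d : ℝ) * l)) := by
    intro d hd l hl
    have hd1 : 1 ≤ d := (Finset.mem_Icc.mp hd).1
    have hl1 : 1 ≤ l := (Finset.mem_Icc.mp hl).1
    have hd0 : (0 : ℝ) < d := by exact_mod_cast hd1
    have hl0 : (0 : ℝ) < l := by exact_mod_cast hl1
    have hW0 : 0 ≤ W (d * l) := zero_le_one.trans (one_le_weight (abs_nonneg c₀) _)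
    have hrhs0 : 0 ≤ Cb * E D * (tau 2 (d * l) * W (d * l) / ((d : ℝ) * l)) := by
      have := tau_nonneg 2 (d * l); positivity
    by_cases hbz : b (d * l) = 0
    · rw [hbz]; simp only [zero_mul, zero_div, norm_zero]; exact hrhs0
    · have hcop : Nat.Coprime (d * l) D := coprime_of_bChi_ne_zero χ hbz
      have hlt : ((d * l : ℕ) : ℝ) < bigP D * t0 D / bigT D ^ 3 := lt_of_bChi_ne_zero χ hℓ3 hbz
      have e := e15 hA d l hd1 hl1 hlt hcop
      have hE : ‖calD1 c' χ d l - mainDL d l‖ ≤ E D * W (d * l) :=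
        e.trans (mul_le_mul_of_nonneg_left (weight_le_weight_abs c₀ _) hE0)
      have hbn : ‖b (d * l)‖ ≤ Cb * tau 2 (d * l) := norm_bChi_le χ hlog2 _
      have hχn : ‖χ (l : ZMod D)‖ ≤ 1 := χ.norm_le_one _
      have hden : ‖((d : ℂ) * l)‖ = (d : ℝ) * l := by
        rw [norm_mul, Complex.norm_natCast, Complex.norm_natCast]
      rw [norm_mul, norm_div, norm_mul, hden]
      have hdl0 : (0 : ℝ) < (d : ℝ) * l := mul_pos hd0 hl0
      calc ‖b (d * l)‖ * ‖χ (l : ZMod D)‖ / ((d : ℝ) * l) * ‖calD1 c' χ d l - mainDL d l‖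
          ≤ (Cb * tau 2 (d * l) * 1) / ((d : ℝ) * l) * (E D * W (d * l)) := by
            refine mul_le_mul ?_ hE (norm_nonneg _) (by have := tau_nonneg 2 (d * l); positivity)
            exact div_le_div_of_nonneg_right (mul_le_mul hbn hχn (norm_nonneg _)
              (by have := tau_nonneg 2 (d * l); positivity)) hdl0.le
        _ = Cb * E D * (tau 2 (d * l) * W (d * l) / ((d : ℝ) * l)) := by ring
  -- the difference of the box sums
  have hdiff : S1 - S2 = ∑ d ∈ Icc 1 N, ∑ l ∈ Icc 1 N,
      b (d * l) * χ (l : ZMod D) / ((d : ℂ) * l) * (calD1 c' χ d l - mainDL d l) := by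
    rw [hS1, hS2, ← Finset.sum_sub_distrib]
    refine Finset.sum_congr rfl fun d _ => ?_
    rw [← Finset.sum_sub_distrib]
    refine Finset.sum_congr rfl fun l _ => ?_
    ring
  have hdiff_le : ‖S1 - S2‖ ≤ Cb * E D * (Cw * Real.log ((N : ℝ) + 1) ^ 6) := by
    rw [hdiff]
    calc ‖∑ d ∈ Icc 1 N, ∑ l ∈ Icc 1 N,
            b (d * l) * χ (l : ZMod D) / ((d : ℂ) * l) * (calD1 c' χ d l - mainDL d l)‖
        ≤ ∑ d ∈ Icc 1 N, ‖∑ l ∈ Icc 1 N,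
            b (d * l) * χ (l : ZMod D) / ((d : ℂ) * l) * (calD1 c' χ d l - mainDL d l)‖ :=
          norm_sum_le _ _
      _ ≤ ∑ d ∈ Icc 1 N, ∑ l ∈ Icc 1 N,
            ‖b (d * l) * χ (l : ZMod D) / ((d : ℂ) * l) * (calD1 c' χ d l - mainDL d l)‖ :=
          Finset.sum_le_sum fun d _ => norm_sum_le _ _
      _ ≤ ∑ d ∈ Icc 1 N, ∑ l ∈ Icc 1 N, Cb * E D * (tau 2 (d * l) * W (d * l) / ((d : ℝ) * l)) :=
          Finset.sum_le_sum fun d hd => Finset.sum_le_sum fun l hl => hterm d hd l hl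
      _ = Cb * E D * ∑ d ∈ Icc 1 N, ∑ l ∈ Icc 1 N, tau 2 (d * l) * W (d * l) / ((d : ℝ) * l) := by
          rw [Finset.mul_sum]
          refine Finset.sum_congr rfl fun d _ => ?_
          rw [Finset.mul_sum]
      _ ≤ Cb * E D * (Cw * Real.log ((N : ℝ) + 1) ^ 6) :=
          mul_le_mul_of_nonneg_left (hw N hN2) (mul_nonneg hCb0 hE0)
  -- the prefactor
  have hRpre : ‖Rpre‖ ≤ CR * ℓ ^ 2 * (2 * ℓ) * p := by
    have e : ‖Rpre‖ = ‖calR1star c' χ‖ * ((D : ℝ) / Nat.totient D) * p := by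
      rw [hRpre, norm_div, norm_mul, norm_mul, Complex.norm_natCast, Complex.norm_natCast,
        Complex.norm_natCast]
      field_simp
    rw [e]
    have h1 : (D : ℝ) / Nat.totient D ≤ 2 * ℓ := hDφ.trans (by linarith)
    have h2 : ‖calR1star c' χ‖ * ((D : ℝ) / Nat.totient D) ≤ CR * ℓ ^ 2 * (2 * ℓ) :=
      mul_le_mul hRs h1 (by positivity) (by positivity)
    exact mul_le_mul_of_nonneg_right h2 hp0.le
  -- the error is `≤ (ε/2)·p`
  have hpow : Real.log ((N : ℝ) + 1) ^ 6 ≤ 2 ^ 6 * ℓ ^ 54 := by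
    have h0 : 0 ≤ Real.log ((N : ℝ) + 1) := Real.log_nonneg (by
      have : (0 : ℝ) ≤ N := Nat.cast_nonneg N; linarith)
    calc Real.log ((N : ℝ) + 1) ^ 6 ≤ (2 * ℓ ^ 9) ^ 6 := pow_le_pow_left₀ h0 hlogN 6
      _ = 2 ^ 6 * ℓ ^ 54 := by ring
  have herr : ‖Rpre * (S1 - S2)‖ ≤ ε / 2 * p := by
    rw [norm_mul]
    have h1 : ‖Rpre‖ * ‖S1 - S2‖ ≤ (CR * ℓ ^ 2 * (2 * ℓ) * p) * (Cb * E D * (Cw * (2 ^ 6 * ℓ ^ 54))) := by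
      refine mul_le_mul hRpre (hdiff_le.trans ?_) (norm_nonneg _) (by positivity)
      exact mul_le_mul_of_nonneg_left (mul_le_mul_of_nonneg_left hpow hCw0) (mul_nonneg hCb0 hE0)
    have h2 : (CR * ℓ ^ 2 * (2 * ℓ) * p) * (Cb * E D * (Cw * (2 ^ 6 * ℓ ^ 54))) =
        K * (E D * ℓ ^ 57) * p := by rw [hK]; ring
    have h3 : E D * ℓ ^ 57 ≤ δ := by
      have : ℓ ^ 57 ≤ ℓ ^ 60 := pow_le_pow_right₀ hℓ1 (by norm_num)
      calc E D * ℓ ^ 57 ≤ E D * ℓ ^ 60 := mul_le_mul_of_nonneg_left this hE0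
        _ ≤ δ := hEδ
    have h4 : K * (E D * ℓ ^ 57) * p ≤ K * δ * p :=
      mul_le_mul_of_nonneg_right (mul_le_mul_of_nonneg_left h3 hK0) hp0.le
    have h5 : K * δ ≤ ε / 2 := by
      rw [hδ]
      have hK1 : 0 < K + 1 := by linarith
      rw [show K * (ε / (2 * (K + 1))) = (ε / 2) * (K / (K + 1)) by field_simp]
      have : K / (K + 1) ≤ 1 := (div_le_one hK1).mpr (by linarith)
      exact mul_le_of_le_one_right (by positivity) this
    calc ‖Rpre‖ * ‖S1 - S2‖ ≤ K * (E D * ℓ ^ 57) * p := by rw [← h2]; exact h1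
      _ ≤ K * δ * p := h4
      _ ≤ ε / 2 * p := mul_le_mul_of_nonneg_right h5 hp0.le
  -- assemble
  have hgoal : Phi1pOf c' χ b p - Rpre * ∑ j ∈ ({1, 2, 3} : Finset ℕ), calR1 c' χ j * calS1 c' χ b j =
      (Phi1pOf c' χ b p - Rpre * S1) + Rpre * (S1 - S2) := by
    rw [← h2]; ring
  have hfin : ‖Phi1pOf c' χ b p -
      Rpre * ∑ j ∈ ({1, 2, 3} : Finset ℕ), calR1 c' χ j * calS1 c' χ b j‖ ≤ ε * p := by
    rw [hgoal]
    calc ‖(Phi1pOf c' χ b p - Rpre * S1) + Rpre * (S1 - S2)‖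
        ≤ ‖Phi1pOf c' χ b p - Rpre * S1‖ + ‖Rpre * (S1 - S2)‖ := norm_add_le _ _
      _ ≤ ε / 2 * P + ε / 2 * p := add_le_add h1 herr
      _ ≤ ε / 2 * p + ε / 2 * p := by
          have : ε / 2 * P ≤ ε / 2 * p := mul_le_mul_of_nonneg_left hPp.le (by positivity)
          linarith
      _ = ε * p := by ring
  simpa only [hbdef, hRpre] using hfin

end Literature.NumberTheory.LFunctions.Zhang2022.Typed.Section15B

end
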